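import Literature.Analysis.FluidPDE.Seregin2020SwirlMoserBasicEstimate
import Literature.Analysis.FluidPDE.Seregin2020SwirlMoserProfile
import HarnessLib

/-!
# Seregin 2020, proof of Thm 2.1: the reverse Hölder inequality (2.5) of the Moser iteration for the swirl

Analysis/FluidPDE proofs file (theorems only: no definitions, no named facts) on the Moser-iteration
half of the proof of G. Seregin, *Local regularity of axisymmetric solutions to the Navier–Stokes
equations*, Anal. Math. Phys. 10 (2020) Paper 46 = arXiv:2006.04140, Thm 2.1 — the swirl bound (2.6),
which is also Lemma 3.3 / (as1) of Seregin–Šverák 2009 (arXiv:0804.1803, §3 p. 9, App. II). PORT (Literature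
placement, so that Literature files may import it) of the Summits-side helper
`Summits/NavierStokesRegularity/NavierStokesRegularity/Theorems/AxisymmetricExtremalityAxisymmetricKatoGlobalStubSeregin2020TypeIIMoserD.lean`
(namespace `Summit.NavierStokesRegularity.NavierStokesRegularity.Theorems.AxisymmetricKatoGlobal.EulerScaling`,
2026-08-17): statements and proofs verbatim, namespace `Literature.Analysis.FluidPDE.Seregin2020`; the
original is untouched. The printed proof (arXiv p. 7)
passes "to the limit as `N → ∞`" in the absorbed basic estimate and obtains "the final estimate
of Step II" (2.5): `‖ω‖_{L^{10/3}(Q(r))} ≤ (cM/√(r₁-r)) (r₁/(r₁-r))² ‖ω‖_{L^{5/2}(Q(r₁))}`,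
`ω = σ^m`, `M = 1 + ‖v‖_{L^{10/3}(Q(r₁))}`, the input of the Moser iteration of Step III. This
file proves it for the tree's form of the argument (sibling modules `…MoserB`, `…MoserC`), in
which `ω = (1 + σ²)^{m/2} ≥ 1` replaces `|σ|^m`, the cylinders are
`Q̄(ρ) = ]-ρ², 0[ × B̄(0, ρ)`, the drift term is absent (radial cut-off), and the constant is
`K(1 + ‖V‖_{L^{10/3}(Q̄(r₁))})/(r₁ - r)` for all `m ≥ 1`, `1/2 ≤ r < r₁ ≤ 1` at once:

* `swirl_moser_limit_le` — `N → ∞` (Fatou; the truncated profiles of `Seregin2020.exists_moserProfile`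
  at level `N = n + 1` equal `ω - 1` eventually, pointwise):
  `∬_{Q̄(r)} (ω - 1)^{10/3} ≤ (K(C_Φ,C_T)(1 + ‖V‖_{10/3})(r₁-r)⁻¹ ‖ω‖_{L^{5/2}(Q̄(r₁))})^{10/3}`;
* `swirl_moser_reverseHolder` (registered sub-goal) — (2.5): there is an absolute `K` with
  `(∬_{Q̄(r)} (1+σ²)^{(5/3)m})^{3/10} ≤ K (1 + ‖V‖_{L^{10/3}(Q̄(r₁))}) (r₁-r)⁻¹ (∬_{Q̄(r₁)} (1+σ²)^{(5/4)m})^{2/5}`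
  for every `(V, P)` in the Seregin–Zajaczkowski class off the axis on `]lo, 0[ × U` (`U ⊇ B̄(0,r₁) ∖ axis`),
  `m ≥ 1`, `1/2 ≤ r < r₁ ≤ 1` (Minkowski for the `+1`, `|Q̄(r)| ≥ |Q̄(1/2)| > 0`);
* `swirl_moser_start_le` — the start of the iteration (Step I of the paper, `m = 4/3`):
  `∬_{Q̄(r₁)} (1+σ²)^{5/3} ≤ 2^{7/3}(|Q̄(r₁)| + ∬_{Q̄(r₁)} |V|^{10/3})` (`|σ| ≤ ϱ|V| ≤ |V|`).

## References

* G. Seregin, Anal. Math. Phys. 10 (2020), Paper 46 = arXiv:2006.04140, proof of Thm. 2.1,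
  Steps I–II, (2.5) (arXiv pp. 6–7). [Seregin2020]
-/

noncomputable section

open MeasureTheory Set Function Filter Topology TopologicalSpace Metric
open scoped NNReal ENNReal InnerProductSpace RealInnerProductSpace

namespace Literature.Analysis.FluidPDE.Seregin2020

open Literature.Analysis.FluidPDE Literature.Analysis.FluidPDE.SereginZajaczkowski2007
  Literature.Analysis.FluidPDE.SereginSverak2009 Literature.Analysis.FluidPDE.Seregin2020
  Literature.Analysis.FluidPDE.LeiZhang2011

section Limit

variable {V : ℝ → EuclideanSpace ℝ (Fin 3) → EuclideanSpace ℝ (Fin 3)} {P : ℝ → EuclideanSpace ℝ (Fin 3) → ℝ}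
  {S : Opens (ℝ × EuclideanSpace ℝ (Fin 3))} {lo : ℝ} {U : Set (EuclideanSpace ℝ (Fin 3))}

/-- **`N → ∞` in the absorbed basic estimate** (Seregin 2020, proof of Thm 2.1, arXiv p. 7:
"by passing to the limit as `N → ∞`"). With `ω = (1+σ²)^{m/2}`, `m ≥ 1`, in the setting of
`swirl_moser_truncated_le`:
`∬_{Q̄(r)} ofReal(ω - 1)^{10/3} ≤ (K(C_Φ,C_T) (1 + ‖V‖_{L^{10/3}(Q̄(r₁))}^{·}) (r₁-r)⁻¹ ‖ω‖_{L^{5/2}(Q̄(r₁))})^{10/3}`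
(the truncated profiles at the levels `N = n + 1` are eventually `ω - 1` at every point; Fatou;
on `Q̄(r)` the cut-offs `χ`, `Φ` equal `1`).
[cite: Seregin2020, proof of Thm 2.1, Step II, passing to the limit N → ∞ (arXiv p. 7)] -/
theorem swirl_moser_limit_le (hU : IsOpen U)
    (hSU : (S : Set (ℝ × EuclideanSpace ℝ (Fin 3))) = Ioo lo 0 ×ˢ U)
    (hS : ∀ θ : ℝ, ∀ z ∈ (S : Set (ℝ × EuclideanSpace ℝ (Fin 3))), stRot θ z ∈ (S : Set (ℝ × EuclideanSpace ℝ (Fin 3))))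
    (hUρ : ∀ x ∈ U, cylRadius x ≠ 0) (hV : IsSmoothAxisymmetricSolutionOn S V P)
    {m : ℝ} (hm : 1 ≤ m) {r r₁ : ℝ} (hr : 0 ≤ r) (hrr₁ : r < r₁) (hr₁ : r₁ ≤ 1) (hlo : lo < -r₁ ^ 2)
    (hBU : ∀ x : EuclideanSpace ℝ (Fin 3), ‖x‖ ≤ r₁ → cylRadius x ≠ 0 → x ∈ U)
    {CΦ CT : ℝ} (hCΦ0 : 0 ≤ CΦ)
    (hCΦ : ∀ z : EuclideanSpace ℝ (Fin 3), ‖gradient (radialCutoff r r₁ : EuclideanSpace ℝ (Fin 3) → ℝ) z‖ ≤ CΦ / (r₁ - r))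
    (hCT : ∀ t, |deriv Real.smoothTransition t| ≤ CT)
    (hIV : (∫⁻ p in Ioo (-r₁ ^ 2) 0 ×ˢ closedBall (0 : EuclideanSpace ℝ (Fin 3)) r₁, ‖V p.1 p.2‖ₑ ^ (10 / 3 : ℝ)
      ∂((volume : Measure ℝ).prod (volume : Measure (EuclideanSpace ℝ (Fin 3))))) < ⊤) :
    ∫⁻ p in Ioo (-r ^ 2) 0 ×ˢ closedBall (0 : EuclideanSpace ℝ (Fin 3)) r,
        ENNReal.ofReal (Real.sqrt (1 + swirl (V p.1) p.2 ^ 2) ^ m - 1) ^ (10 / 3 : ℝ)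
        ∂((volume : Measure ℝ).prod (volume : Measure (EuclideanSpace ℝ (Fin 3)))) ≤
      (((2 * (3 * (SNormLESNormFDerivOfEqConst ℝ (volume : Measure (EuclideanSpace ℝ (Fin 3))) 2 : ℝ≥0∞) ^ 2) ^ (3 / 5 : ℝ) *
            ENNReal.ofReal (8 * CΦ ^ 2 + 2 * CT) *
            volume (closedBall (0 : EuclideanSpace ℝ (Fin 3)) 1) ^ (1 / 5 : ℝ)) ^ (1 / 2 : ℝ) +
          (3 * (SNormLESNormFDerivOfEqConst ℝ (volume : Measure (EuclideanSpace ℝ (Fin 3))) 2 : ℝ≥0∞) ^ 2) ^ (3 / 5 : ℝ) *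
            ENNReal.ofReal (2 * CΦ)) *
        (1 + (∫⁻ p in Ioo (-r₁ ^ 2) 0 ×ˢ closedBall (0 : EuclideanSpace ℝ (Fin 3)) r₁, ‖V p.1 p.2‖ₑ ^ (10 / 3 : ℝ)
          ∂((volume : Measure ℝ).prod (volume : Measure (EuclideanSpace ℝ (Fin 3))))) ^ (3 / 10 : ℝ)) *
        ENNReal.ofReal ((r₁ - r)⁻¹) *
        (∫⁻ p in Ioo (-r₁ ^ 2) 0 ×ˢ closedBall (0 : EuclideanSpace ℝ (Fin 3)) r₁,
          ENNReal.ofReal (Real.sqrt (1 + swirl (V p.1) p.2 ^ 2) ^ m) ^ (5 / 2 : ℝ)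
          ∂((volume : Measure ℝ).prod (volume : Measure (EuclideanSpace ℝ (Fin 3))))) ^ (2 / 5 : ℝ)) ^ (10 / 3 : ℝ) := by
  -- notation
  set R : ℝ≥0∞ := ((2 * (3 * (SNormLESNormFDerivOfEqConst ℝ (volume : Measure (EuclideanSpace ℝ (Fin 3))) 2 : ℝ≥0∞) ^ 2) ^ (3 / 5 : ℝ) *
            ENNReal.ofReal (8 * CΦ ^ 2 + 2 * CT) *
            volume (closedBall (0 : EuclideanSpace ℝ (Fin 3)) 1) ^ (1 / 5 : ℝ)) ^ (1 / 2 : ℝ) +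
          (3 * (SNormLESNormFDerivOfEqConst ℝ (volume : Measure (EuclideanSpace ℝ (Fin 3))) 2 : ℝ≥0∞) ^ 2) ^ (3 / 5 : ℝ) *
            ENNReal.ofReal (2 * CΦ)) *
        (1 + (∫⁻ p in Ioo (-r₁ ^ 2) 0 ×ˢ closedBall (0 : EuclideanSpace ℝ (Fin 3)) r₁, ‖V p.1 p.2‖ₑ ^ (10 / 3 : ℝ)
          ∂((volume : Measure ℝ).prod (volume : Measure (EuclideanSpace ℝ (Fin 3))))) ^ (3 / 10 : ℝ)) *
        ENNReal.ofReal ((r₁ - r)⁻¹) *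
        (∫⁻ p in Ioo (-r₁ ^ 2) 0 ×ˢ closedBall (0 : EuclideanSpace ℝ (Fin 3)) r₁,
          ENNReal.ofReal (Real.sqrt (1 + swirl (V p.1) p.2 ^ 2) ^ m) ^ (5 / 2 : ℝ)
          ∂((volume : Measure ℝ).prod (volume : Measure (EuclideanSpace ℝ (Fin 3))))) ^ (2 / 5 : ℝ) with hR
  set I : Set ℝ := Ioo (-r₁ ^ 2) 0 with hI
  set μ' : Measure (ℝ × EuclideanSpace ℝ (Fin 3)) := (volume.restrict I).prod volume with hμ'
  set Φ : EuclideanSpace ℝ (Fin 3) → ℝ := radialCutoff r r₁ with hΦdef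
  set ω : ℝ × EuclideanSpace ℝ (Fin 3) → ℝ := fun p => Real.sqrt (1 + swirl (V p.1) p.2 ^ 2) ^ m with hω
  obtain ⟨χ, hχ⟩ : ∃ χ : ℝ → ℝ, ∀ s, χ s = Real.smoothTransition ((s + r₁ ^ 2) / (r₁ ^ 2 - r ^ 2)) := ⟨_, fun _ => rfl⟩
  have hm0 : 0 ≤ m := zero_le_one.trans hm
  have hT : r ^ 2 < r₁ ^ 2 := by nlinarith
  have hIoo : I ⊆ Ioo lo 0 := Ioo_subset_Ioo hlo.le le_rfl
  obtain ⟨hχC, -, hχone, -, -⟩ := timeCutoff_props hT hCT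
  rw [show (fun s : ℝ => Real.smoothTransition ((s + r₁ ^ 2) / (r₁ ^ 2 - r ^ 2))) = χ from (funext hχ).symm] at hχC
  simp only [← hχ] at hχone
  have hf1 : ∀ τ : ℝ, 1 ≤ Real.sqrt (1 + τ ^ 2) := fun τ => by
    rw [Real.le_sqrt zero_le_one (by positivity)]; nlinarith
  have hω1 : ∀ p, 1 ≤ ω p := fun p => Real.one_le_rpow (hf1 _) hm0
  -- the truncated profiles at the levels `N = n + 1`
  have hprof : ∀ n : ℕ, ∃ s H : ℝ → ℝ, ∃ L : ℝ, 0 ≤ L ∧ ContDiff ℝ 2 s ∧ ContDiff ℝ 2 H ∧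
      (∀ τ, H τ = s τ ^ 2) ∧ (∀ τ, 0 ≤ s τ) ∧ s 0 = 0 ∧ (∀ τ, 0 ≤ deriv (deriv H) τ) ∧
      (∀ τ, 2 * deriv s τ ^ 2 ≤ deriv (deriv H) τ) ∧ (∀ τ, deriv H τ ^ 2 ≤ 2 * H τ * deriv (deriv H) τ) ∧
      (∀ τ, s τ ≤ Real.sqrt (1 + τ ^ 2) ^ m - 1) ∧ (∀ τ, H τ ≤ L * τ ^ 2) ∧
      (∀ τ, Real.sqrt (1 + τ ^ 2) ≤ (n : ℝ) + 1 → s τ = Real.sqrt (1 + τ ^ 2) ^ m - 1) := fun n =>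
    exists_moserProfile hm (N := (n : ℝ) + 1) (by have : (0 : ℝ) ≤ n := n.cast_nonneg; linarith)
  choose sN HN LN hLN hsC hHC hHs hs0 _hs00 _hH2 hs2 hκ hsle hHL hexact using hprof
  set f : ℕ → ℝ × EuclideanSpace ℝ (Fin 3) → ℝ≥0∞ := fun n p =>
    ‖χ p.1 * (Φ p.2 * sN n (swirl (V p.1) p.2))‖ₑ ^ (10 / 3 : ℝ) with hf
  -- (1) the bound at each level
  have hbound : ∀ n, ∫⁻ p, f n p ∂μ' ≤ R ^ (10 / 3 : ℝ) := by
    intro n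
    have h := swirl_moser_truncated_le V P S lo U hU hSU hS hUρ hV m r r₁ hm0 hr hrr₁ hr₁ hlo hBU CΦ CT hCΦ0 hCΦ hCT χ hχ
      (sN n) (HN n) (LN n) (hLN n) (hsC n) (hHC n) (hHs n) (hs0 n) (hs2 n) (hκ n) (hsle n) (hHL n) hIV
    calc (∫⁻ p, f n p ∂μ') = ((∫⁻ p, f n p ∂μ') ^ (3 / 10 : ℝ)) ^ (10 / 3 : ℝ) := by
          rw [← ENNReal.rpow_mul]; norm_num
      _ ≤ R ^ (10 / 3 : ℝ) := ENNReal.rpow_le_rpow h (by norm_num)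
  -- (2) measurability of each level
  have hfM : ∀ n, AEMeasurable (f n) μ' := by
    intro n
    have hcont : ContinuousOn (fun p : ℝ × EuclideanSpace ℝ (Fin 3) => χ p.1 * (Φ p.2 * sN n (swirl (V p.1) p.2)))
        (S : Set (ℝ × EuclideanSpace ℝ (Fin 3))) :=
      (hχC.continuous.comp continuous_fst).continuousOn.mul
        (((radialCutoff_contDiff r r₁ (n := 0)).continuous.comp continuous_snd).continuousOn.mul
          ((hsC n).continuous.comp_continuousOn hV.continuousOn_swirl))
    have hoff := continuousOn_offAxis_of_eq_zero hSU hBU hcont (fun p hp => by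
      show χ p.1 * (Φ p.2 * sN n (swirl (V p.1) p.2)) = 0
      rw [show Φ p.2 = 0 from radialCutoff_eq_zero hr hrr₁ hp.le]
      simp) hIoo
    exact (aemeasurable_prod_of_continuousOn_offAxis measurableSet_Ioo hoff).enorm.pow_const _
  -- (3) the levels are eventually `ω - 1`, pointwise
  have hlim : ∀ p, ‖χ p.1 * (Φ p.2 * (ω p - 1))‖ₑ ^ (10 / 3 : ℝ) = liminf (fun n => f n p) atTop := by
    intro p
    obtain ⟨N₀, hN₀⟩ := exists_nat_ge (Real.sqrt (1 + swirl (V p.1) p.2 ^ 2))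
    have hev : ∀ᶠ n in atTop, f n p = ‖χ p.1 * (Φ p.2 * (ω p - 1))‖ₑ ^ (10 / 3 : ℝ) := by
      refine eventually_atTop.2 ⟨N₀, fun n hn => ?_⟩
      have hle : Real.sqrt (1 + swirl (V p.1) p.2 ^ 2) ≤ (n : ℝ) + 1 :=
        hN₀.trans ((Nat.cast_le.2 hn).trans (le_add_of_nonneg_right zero_le_one))
      simp only [hf, hexact n _ hle, hω]
    rw [liminf_congr hev, liminf_const]
  -- (4) Fatou
  have hZ : ∫⁻ p, ‖χ p.1 * (Φ p.2 * (ω p - 1))‖ₑ ^ (10 / 3 : ℝ) ∂μ' ≤ R ^ (10 / 3 : ℝ) := by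
    calc (∫⁻ p, ‖χ p.1 * (Φ p.2 * (ω p - 1))‖ₑ ^ (10 / 3 : ℝ) ∂μ')
        = ∫⁻ p, liminf (fun n => f n p) atTop ∂μ' := lintegral_congr fun p => hlim p
      _ ≤ liminf (fun n => ∫⁻ p, f n p ∂μ') atTop := lintegral_liminf_le' hfM
      _ ≤ liminf (fun _ : ℕ => R ^ (10 / 3 : ℝ)) atTop := liminf_le_liminf (Eventually.of_forall hbound)
      _ = R ^ (10 / 3 : ℝ) := liminf_const _
  -- (5) on `Q̄(r)` the cut-offs are `1`
  refine le_trans ?_ hZ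
  have hle : ((volume : Measure ℝ).prod (volume : Measure (EuclideanSpace ℝ (Fin 3)))).restrict
      (Ioo (-r ^ 2) 0 ×ˢ closedBall (0 : EuclideanSpace ℝ (Fin 3)) r) ≤ μ' := by
    rw [← Measure.prod_restrict, hμ']
    exact Measure.prod_mono (Measure.restrict_mono (Ioo_subset_Ioo (by nlinarith) le_rfl) le_rfl) Measure.restrict_le_self
  calc (∫⁻ p in Ioo (-r ^ 2) 0 ×ˢ closedBall (0 : EuclideanSpace ℝ (Fin 3)) r, ENNReal.ofReal (ω p - 1) ^ (10 / 3 : ℝ)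
        ∂((volume : Measure ℝ).prod (volume : Measure (EuclideanSpace ℝ (Fin 3)))))
      = ∫⁻ p in Ioo (-r ^ 2) 0 ×ˢ closedBall (0 : EuclideanSpace ℝ (Fin 3)) r, ‖χ p.1 * (Φ p.2 * (ω p - 1))‖ₑ ^ (10 / 3 : ℝ)
          ∂((volume : Measure ℝ).prod (volume : Measure (EuclideanSpace ℝ (Fin 3)))) := by
        refine setLIntegral_congr_fun (measurableSet_Ioo.prod measurableSet_closedBall) fun p hp => ?_
        have h1 : χ p.1 = 1 := hχone p.1 hp.1.1.le
        have h2 : Φ p.2 = 1 := radialCutoff_eq_one hr hrr₁ (mem_closedBall_zero_iff.1 hp.2)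
        rw [h1, h2, one_mul, one_mul, Real.enorm_eq_ofReal (by linarith [hω1 p])]
    _ ≤ _ := lintegral_mono' hle le_rfl

end Limit

/-! ### The reverse Hölder inequality (2.5) -/

/-- **Seregin 2020, proof of Thm 2.1, (2.5): the reverse Hölder inequality of the Moser iteration
for the swirl.** There is an absolute constant `K` such that for every `(V, P)` in the
Seregin–Zajaczkowski class on `S = ]lo, 0[ × U` (`U` open, off the axis, rotation invariant,
containing the off-axis points of `B̄(0, r₁)`; e.g. the off-axis smooth representative of an
axisymmetric suitable weak solution in `Q = 𝒞 × ]-1,0[`), every `m ≥ 1` and all radii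
`1/2 ≤ r < r₁ ≤ 1` with `lo < -r₁²`:
`(∬_{Q̄(r)} u^{(10/3)m})^{3/10} ≤ K (1 + ‖V‖_{L^{10/3}(Q̄(r₁))}^{·}) (r₁ - r)⁻¹ (∬_{Q̄(r₁)} u^{(5/2)m})^{2/5}`,
`u = (1 + σ²)^{1/2} ≥ max(1, |σ|)`, `σ = ϱv_φ` the swirl, `Q̄(ρ) = ]-ρ², 0[ × B̄(0, ρ)`, where
`‖V‖^{·} = (∬_{Q̄(r₁)}|V|^{10/3})^{3/10}` (the paper's (2.5) with `M = 1 + ‖v‖_{L^{10/3}}`, in the tree's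
form: `u^m` for `|σ|^m`, no drift term, constant `K M/(r₁-r)` for all `m`). Along `m_k = (4/3)^k m₀`,
`(10/3)m_k = (5/2)m_{k+1}`: these are the reverse Hölder inequalities fed to the Moser iteration
(Step III). [cite: Seregin2020, proof of Thm 2.1, Step II, (2.5) (arXiv p. 7)] -/
theorem swirl_moser_reverseHolder :
    ∃ K : ℝ≥0, ∀ (V : ℝ → EuclideanSpace ℝ (Fin 3) → EuclideanSpace ℝ (Fin 3)) (P : ℝ → EuclideanSpace ℝ (Fin 3) → ℝ)
      (S : TopologicalSpace.Opens (ℝ × EuclideanSpace ℝ (Fin 3))) (lo : ℝ) (U : Set (EuclideanSpace ℝ (Fin 3))),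
      IsOpen U → (S : Set (ℝ × EuclideanSpace ℝ (Fin 3))) = Ioo lo 0 ×ˢ U →
      (∀ θ : ℝ, ∀ z ∈ (S : Set (ℝ × EuclideanSpace ℝ (Fin 3))),
        SereginZajaczkowski2007.stRot θ z ∈ (S : Set (ℝ × EuclideanSpace ℝ (Fin 3)))) →
      (∀ x ∈ U, cylRadius x ≠ 0) → SereginZajaczkowski2007.IsSmoothAxisymmetricSolutionOn S V P →
    ∀ (m r r₁ : ℝ), 1 ≤ m → 1 / 2 ≤ r → r < r₁ → r₁ ≤ 1 → lo < -r₁ ^ 2 →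
      (∀ x : EuclideanSpace ℝ (Fin 3), ‖x‖ ≤ r₁ → cylRadius x ≠ 0 → x ∈ U) →
    (∫⁻ p in Ioo (-r ^ 2) 0 ×ˢ Metric.closedBall (0 : EuclideanSpace ℝ (Fin 3)) r,
        ENNReal.ofReal (Real.sqrt (1 + swirl (V p.1) p.2 ^ 2)) ^ (10 / 3 * m)
        ∂((volume : Measure ℝ).prod (volume : Measure (EuclideanSpace ℝ (Fin 3))))) ^ (3 / 10 : ℝ) ≤
      K * (1 + (∫⁻ p in Ioo (-r₁ ^ 2) 0 ×ˢ Metric.closedBall (0 : EuclideanSpace ℝ (Fin 3)) r₁, ‖V p.1 p.2‖ₑ ^ (10 / 3 : ℝ)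
          ∂((volume : Measure ℝ).prod (volume : Measure (EuclideanSpace ℝ (Fin 3))))) ^ (3 / 10 : ℝ)) /
        ENNReal.ofReal (r₁ - r) *
      (∫⁻ p in Ioo (-r₁ ^ 2) 0 ×ˢ Metric.closedBall (0 : EuclideanSpace ℝ (Fin 3)) r₁,
        ENNReal.ofReal (Real.sqrt (1 + swirl (V p.1) p.2 ^ 2)) ^ (5 / 2 * m)
        ∂((volume : Measure ℝ).prod (volume : Measure (EuclideanSpace ℝ (Fin 3))))) ^ (2 / 5 : ℝ) := by
  obtain ⟨CΦ, hCΦ0, hCΦ⟩ := exists_norm_gradient_radialCutoff_le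
  obtain ⟨CT, -, hCT⟩ := LeiZhang2011.exists_abs_deriv_smoothTransition_le
  set C : ℝ≥0∞ := 3 * (SNormLESNormFDerivOfEqConst ℝ (volume : Measure (EuclideanSpace ℝ (Fin 3))) 2 : ℝ≥0∞) ^ 2 with hC
  set V₁ : ℝ≥0∞ := volume (closedBall (0 : EuclideanSpace ℝ (Fin 3)) 1) with hV₁
  set K₁ : ℝ≥0∞ := (2 * C ^ (3 / 5 : ℝ) * ENNReal.ofReal (8 * CΦ ^ 2 + 2 * CT) * V₁ ^ (1 / 5 : ℝ)) ^ (1 / 2 : ℝ) +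
    C ^ (3 / 5 : ℝ) * ENNReal.ofReal (2 * CΦ) with hK₁
  set q₀ : ℝ≥0∞ := ((volume : Measure ℝ).prod (volume : Measure (EuclideanSpace ℝ (Fin 3))))
    (Ioo (-(1 / 2) ^ 2) 0 ×ˢ closedBall (0 : EuclideanSpace ℝ (Fin 3)) (1 / 2)) with hq₀def
  set K₂ : ℝ≥0∞ := (q₀ ^ (1 / 10 : ℝ))⁻¹ with hK₂
  have hCt : C ≠ ⊤ := ENNReal.mul_ne_top (by norm_num) (ENNReal.pow_ne_top ENNReal.coe_ne_top)
  have hV₁t : V₁ ≠ ⊤ := measure_closedBall_lt_top.ne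
  have hq₀ : q₀ ≠ 0 := by
    rw [hq₀def, Measure.prod_prod, Real.volume_Ioo]
    exact mul_ne_zero (ENNReal.ofReal_pos.2 (by norm_num)).ne' (measure_closedBall_pos volume _ (by norm_num)).ne'
  have hq₀t : q₀ ≠ ⊤ := by
    rw [hq₀def, Measure.prod_prod, Real.volume_Ioo]
    exact ENNReal.mul_ne_top ENNReal.ofReal_ne_top measure_closedBall_lt_top.ne
  have hK₂t : K₂ ≠ ⊤ := ENNReal.inv_ne_top.2 (ENNReal.rpow_pos (pos_iff_ne_zero.2 hq₀) hq₀t).ne'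
  have hK₂0 : K₂ ≠ 0 := (ENNReal.inv_pos.2 (ENNReal.rpow_ne_top_of_nonneg (by norm_num) hq₀t)).ne'
  have hK₁t : K₁ ≠ ⊤ := by
    refine ENNReal.add_ne_top.2 ⟨ENNReal.rpow_ne_top_of_nonneg (by norm_num) ?_, ?_⟩
    · exact ENNReal.mul_ne_top (ENNReal.mul_ne_top (ENNReal.mul_ne_top (by norm_num)
        (ENNReal.rpow_ne_top_of_nonneg (by norm_num) hCt)) ENNReal.ofReal_ne_top) (ENNReal.rpow_ne_top_of_nonneg (by norm_num) hV₁t)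
    · exact ENNReal.mul_ne_top (ENNReal.rpow_ne_top_of_nonneg (by norm_num) hCt) ENNReal.ofReal_ne_top
  have hKt : K₁ + K₂ ≠ ⊤ := ENNReal.add_ne_top.2 ⟨hK₁t, hK₂t⟩
  have hK0 : K₁ + K₂ ≠ 0 := fun h => hK₂0 (add_eq_zero.1 h).2
  refine ⟨(K₁ + K₂).toNNReal, ?_⟩
  intro V P S lo U hU hSU hS hUρ hV m r r₁ hm hr2 hrr₁ hr₁ hlo hBU
  rw [ENNReal.coe_toNNReal hKt]
  have hr : 0 ≤ r := by linarith
  have hm0 : 0 ≤ m := zero_le_one.trans hm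
  have hd0 : 0 < r₁ - r := sub_pos.2 hrr₁
  -- exponents
  have hf0 : ∀ p : ℝ × EuclideanSpace ℝ (Fin 3), 0 ≤ Real.sqrt (1 + swirl (V p.1) p.2 ^ 2) := fun p => Real.sqrt_nonneg _
  have e103 : ∀ p : ℝ × EuclideanSpace ℝ (Fin 3), ENNReal.ofReal (Real.sqrt (1 + swirl (V p.1) p.2 ^ 2)) ^ (10 / 3 * m) =
      ENNReal.ofReal (Real.sqrt (1 + swirl (V p.1) p.2 ^ 2) ^ m) ^ (10 / 3 : ℝ) := fun p => by
    rw [mul_comm, ENNReal.rpow_mul, ENNReal.ofReal_rpow_of_nonneg (hf0 p) hm0]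
  have e52 : ∀ p : ℝ × EuclideanSpace ℝ (Fin 3), ENNReal.ofReal (Real.sqrt (1 + swirl (V p.1) p.2 ^ 2)) ^ (5 / 2 * m) =
      ENNReal.ofReal (Real.sqrt (1 + swirl (V p.1) p.2 ^ 2) ^ m) ^ (5 / 2 : ℝ) := fun p => by
    rw [mul_comm, ENNReal.rpow_mul, ENNReal.ofReal_rpow_of_nonneg (hf0 p) hm0]
  simp_rw [e103, e52]
  -- notation
  set ω : ℝ × EuclideanSpace ℝ (Fin 3) → ℝ := fun p => Real.sqrt (1 + swirl (V p.1) p.2 ^ 2) ^ m with hω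
  set I₂ : ℝ≥0∞ := ∫⁻ p in Ioo (-r₁ ^ 2) 0 ×ˢ closedBall (0 : EuclideanSpace ℝ (Fin 3)) r₁, ENNReal.ofReal (ω p) ^ (5 / 2 : ℝ)
    ∂((volume : Measure ℝ).prod (volume : Measure (EuclideanSpace ℝ (Fin 3)))) with hI₂
  set IV : ℝ≥0∞ := ∫⁻ p in Ioo (-r₁ ^ 2) 0 ×ˢ closedBall (0 : EuclideanSpace ℝ (Fin 3)) r₁, ‖V p.1 p.2‖ₑ ^ (10 / 3 : ℝ)
    ∂((volume : Measure ℝ).prod (volume : Measure (EuclideanSpace ℝ (Fin 3)))) with hIV'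
  set Q : Set (ℝ × EuclideanSpace ℝ (Fin 3)) := Ioo (-r ^ 2) 0 ×ˢ closedBall (0 : EuclideanSpace ℝ (Fin 3)) r with hQ
  set μQ : ℝ≥0∞ := ((volume : Measure ℝ).prod (volume : Measure (EuclideanSpace ℝ (Fin 3)))) Q with hμQ
  set D' : ℝ≥0∞ := ENNReal.ofReal ((r₁ - r)⁻¹) with hD'def
  have hD' : D' = (ENNReal.ofReal (r₁ - r))⁻¹ := ENNReal.ofReal_inv_of_pos hd0
  have hD'1 : 1 ≤ D' := ENNReal.one_le_ofReal.2 ((one_le_inv₀ hd0).2 (by linarith))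
  have hf1 : ∀ τ : ℝ, 1 ≤ Real.sqrt (1 + τ ^ 2) := fun τ => by
    rw [Real.le_sqrt zero_le_one (by positivity)]; nlinarith
  have hω1 : ∀ p, 1 ≤ ω p := fun p => Real.one_le_rpow (hf1 _) hm0
  -- the measures of the cylinders
  have hq₀Q : q₀ ≤ μQ :=
    measure_mono (prod_mono (Ioo_subset_Ioo (by nlinarith) le_rfl) (closedBall_subset_closedBall hr2))
  have hμQt : μQ ≠ ⊤ := by
    rw [hμQ, hQ, Measure.prod_prod, Real.volume_Ioo]
    exact ENNReal.mul_ne_top ENNReal.ofReal_ne_top measure_closedBall_lt_top.ne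
  have hμQ0 : μQ ≠ 0 := (lt_of_lt_of_le (pos_iff_ne_zero.2 hq₀) hq₀Q).ne'
  have hμQI₂ : μQ ≤ I₂ := by
    calc μQ ≤ ((volume : Measure ℝ).prod (volume : Measure (EuclideanSpace ℝ (Fin 3))))
          (Ioo (-r₁ ^ 2) 0 ×ˢ closedBall (0 : EuclideanSpace ℝ (Fin 3)) r₁) :=
          measure_mono (prod_mono (Ioo_subset_Ioo (by nlinarith) le_rfl) (closedBall_subset_closedBall hrr₁.le))
      _ = ∫⁻ _ in Ioo (-r₁ ^ 2) 0 ×ˢ closedBall (0 : EuclideanSpace ℝ (Fin 3)) r₁, (1 : ℝ≥0∞)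
          ∂((volume : Measure ℝ).prod (volume : Measure (EuclideanSpace ℝ (Fin 3)))) := by rw [setLIntegral_const, one_mul]
      _ ≤ I₂ := lintegral_mono fun p => ENNReal.one_le_rpow (ENNReal.one_le_ofReal.2 (hω1 p)) (by norm_num)
  have hI₂0 : I₂ ^ (2 / 5 : ℝ) ≠ 0 := fun h => by
    rcases ENNReal.rpow_eq_zero_iff.1 h with ⟨h1, -⟩ | ⟨-, h2⟩
    · exact (lt_of_lt_of_le (pos_iff_ne_zero.2 hμQ0) hμQI₂).ne' h1
    · norm_num at h2
  -- the trivial case `V ∉ L^{10/3}`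
  by_cases hIVt : IV = ⊤
  · have htop : (K₁ + K₂) * (1 + IV ^ (3 / 10 : ℝ)) / ENNReal.ofReal (r₁ - r) * I₂ ^ (2 / 5 : ℝ) = ⊤ := by
      rw [hIVt, ENNReal.top_rpow_of_pos (by norm_num), add_top, ENNReal.mul_top hK0,
        ENNReal.top_div_of_ne_top ENNReal.ofReal_ne_top, ENNReal.top_mul hI₂0]
    rw [htop]
    exact le_top
  have hIV : IV < ⊤ := lt_top_iff_ne_top.2 hIVt
  -- (1) the limit bound on `Q̄(r)`
  have hlim := swirl_moser_limit_le hU hSU hS hUρ hV hm hr hrr₁ hr₁ hlo hBU hCΦ0 (hCΦ r r₁ hr hrr₁) hCT hIV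
  have h1 : (∫⁻ p in Q, ENNReal.ofReal (ω p - 1) ^ (10 / 3 : ℝ)
      ∂((volume : Measure ℝ).prod (volume : Measure (EuclideanSpace ℝ (Fin 3))))) ^ (3 / 10 : ℝ) ≤
      K₁ * (1 + IV ^ (3 / 10 : ℝ)) * D' * I₂ ^ (2 / 5 : ℝ) := by
    have h := ENNReal.rpow_le_rpow hlim (show (0 : ℝ) ≤ 3 / 10 by norm_num)
    rw [← ENNReal.rpow_mul, show (10 / 3 * (3 / 10) : ℝ) = 1 by norm_num, ENNReal.rpow_one] at h
    exact h
  -- (2) the constant function `1` on `Q̄(r)`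
  have h2 : μQ ^ (3 / 10 : ℝ) ≤ K₂ * (1 + IV ^ (3 / 10 : ℝ)) * D' * I₂ ^ (2 / 5 : ℝ) := by
    calc μQ ^ (3 / 10 : ℝ) = μQ ^ (2 / 5 : ℝ) * μQ ^ (-(1 / 10) : ℝ) := by
          rw [← ENNReal.rpow_add _ _ hμQ0 hμQt]; norm_num
      _ ≤ I₂ ^ (2 / 5 : ℝ) * K₂ := by
          refine mul_le_mul' (ENNReal.rpow_le_rpow hμQI₂ (by norm_num)) ?_
          rw [ENNReal.rpow_neg]
          exact ENNReal.inv_le_inv.2 (ENNReal.rpow_le_rpow hq₀Q (by norm_num))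
      _ = K₂ * 1 * 1 * I₂ ^ (2 / 5 : ℝ) := by ring
      _ ≤ K₂ * (1 + IV ^ (3 / 10 : ℝ)) * D' * I₂ ^ (2 / 5 : ℝ) :=
          mul_le_mul' (mul_le_mul' (mul_le_mul' le_rfl le_self_add) hD'1) le_rfl
  -- (3) Minkowski
  have hωM : AEMeasurable (fun p => ENNReal.ofReal (ω p - 1))
      (((volume : Measure ℝ).prod (volume : Measure (EuclideanSpace ℝ (Fin 3)))).restrict Q) := by
    have e : ((volume : Measure ℝ).prod (volume : Measure (EuclideanSpace ℝ (Fin 3)))).restrict Q =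
        ((volume.restrict (Ioo (-r ^ 2) 0)).prod (volume : Measure (EuclideanSpace ℝ (Fin 3)))).restrict
          (univ ×ˢ closedBall (0 : EuclideanSpace ℝ (Fin 3)) r) := by
      rw [← Measure.prod_restrict, ← Measure.prod_restrict, Measure.restrict_univ]
    rw [e]
    refine ENNReal.measurable_ofReal.comp_aemeasurable
      (aemeasurable_prod_restrict_of_continuousOn_offAxis measurableSet_Ioo measurableSet_closedBall ?_)
    have hc : ContinuousOn (fun p : ℝ × EuclideanSpace ℝ (Fin 3) => ω p - 1) (S : Set (ℝ × EuclideanSpace ℝ (Fin 3))) :=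
      ((Real.continuous_sqrt.comp_continuousOn (continuousOn_const.add (hV.continuousOn_swirl.pow 2))).rpow_const
        fun _ _ => Or.inr hm0).sub continuousOn_const
    refine hc.mono ?_
    rw [hSU]
    rintro p ⟨hp1, hp2, hp3⟩
    exact ⟨⟨hlo.trans (lt_of_le_of_lt (by nlinarith) hp1.1), hp1.2⟩,
      hBU _ ((mem_closedBall_zero_iff.1 hp2).trans hrr₁.le) hp3⟩
  have hmink := ENNReal.lintegral_Lp_add_le (p := 10 / 3) hωM aemeasurable_const (g := fun _ => (1 : ℝ≥0∞)) (by norm_num)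
  have hsum : ∀ p, ENNReal.ofReal (ω p - 1) + 1 = ENNReal.ofReal (ω p) := fun p => by
    rw [← ENNReal.ofReal_one, ← ENNReal.ofReal_add (by linarith [hω1 p]) zero_le_one, sub_add_cancel]
  simp only [Pi.add_apply, hsum, ENNReal.one_rpow, lintegral_const, Measure.restrict_apply_univ, one_mul,
    show (1 / (10 / 3) : ℝ) = 3 / 10 by norm_num] at hmink
  calc (∫⁻ p in Q, ENNReal.ofReal (ω p) ^ (10 / 3 : ℝ) ∂((volume : Measure ℝ).prod (volume : Measure (EuclideanSpace ℝ (Fin 3))))) ^ (3 / 10 : ℝ)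
      ≤ (∫⁻ p in Q, ENNReal.ofReal (ω p - 1) ^ (10 / 3 : ℝ) ∂((volume : Measure ℝ).prod (volume : Measure (EuclideanSpace ℝ (Fin 3))))) ^ (3 / 10 : ℝ) +
          μQ ^ (3 / 10 : ℝ) := hmink
    _ ≤ K₁ * (1 + IV ^ (3 / 10 : ℝ)) * D' * I₂ ^ (2 / 5 : ℝ) + K₂ * (1 + IV ^ (3 / 10 : ℝ)) * D' * I₂ ^ (2 / 5 : ℝ) :=
        add_le_add h1 h2
    _ = (K₁ + K₂) * (1 + IV ^ (3 / 10 : ℝ)) / ENNReal.ofReal (r₁ - r) * I₂ ^ (2 / 5 : ℝ) := by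
        rw [show (K₁ + K₂) * (1 + IV ^ (3 / 10 : ℝ)) / ENNReal.ofReal (r₁ - r) =
          (K₁ + K₂) * (1 + IV ^ (3 / 10 : ℝ)) * (ENNReal.ofReal (r₁ - r))⁻¹ from rfl, ← hD']
        ring

/-! ### The start of the iteration -/

/-- **The start of the Moser iteration** (Seregin 2020, proof of Thm 2.1, Step I, arXiv p. 6:
`m = 4/3`, "taking into account that `ω = (|x'||v_φ|)^{4/3}` … `≤ c(∫_{Q(r₁)}|v|^{10/3})`"): for ANY
field `V` and `r₁ ≤ 1`, with `u = (1 + σ²)^{1/2} ≤ 1 + |σ| ≤ 1 + |V|` on `B̄(0, r₁)` (`|σ| ≤ ϱ|V|`),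
`∬_{Q̄(r₁)} u^{(5/2)(4/3)} ≤ 2^{7/3} (|Q̄(r₁)| + ∬_{Q̄(r₁)} |V|^{10/3})`, `Q̄(r₁) = ]-r₁²,0[ × B̄(0,r₁)`
(the right-hand side of (2.5) at the first level is controlled by `M`).
[cite: Seregin2020, proof of Thm 2.1, Step I (arXiv p. 6)] -/
theorem swirl_moser_start_le (V : ℝ → EuclideanSpace ℝ (Fin 3) → EuclideanSpace ℝ (Fin 3)) {r₁ : ℝ} (hr₁ : r₁ ≤ 1) :
    ∫⁻ p in Ioo (-r₁ ^ 2) 0 ×ˢ closedBall (0 : EuclideanSpace ℝ (Fin 3)) r₁,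
        ENNReal.ofReal (Real.sqrt (1 + swirl (V p.1) p.2 ^ 2)) ^ (5 / 2 * (4 / 3 : ℝ))
        ∂((volume : Measure ℝ).prod (volume : Measure (EuclideanSpace ℝ (Fin 3)))) ≤
      2 ^ (7 / 3 : ℝ) * (((volume : Measure ℝ).prod (volume : Measure (EuclideanSpace ℝ (Fin 3))))
          (Ioo (-r₁ ^ 2) 0 ×ˢ closedBall (0 : EuclideanSpace ℝ (Fin 3)) r₁) +
        ∫⁻ p in Ioo (-r₁ ^ 2) 0 ×ˢ closedBall (0 : EuclideanSpace ℝ (Fin 3)) r₁, ‖V p.1 p.2‖ₑ ^ (10 / 3 : ℝ)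
          ∂((volume : Measure ℝ).prod (volume : Measure (EuclideanSpace ℝ (Fin 3))))) := by
  set Q : Set (ℝ × EuclideanSpace ℝ (Fin 3)) := Ioo (-r₁ ^ 2) 0 ×ˢ closedBall (0 : EuclideanSpace ℝ (Fin 3)) r₁ with hQ
  have hQm : MeasurableSet Q := measurableSet_Ioo.prod measurableSet_closedBall
  -- pointwise on `Q̄(r₁)`: `ofReal(u) ≤ 1 + ‖V‖ₑ`, then convexity of `t ↦ t^{10/3}`
  have hpt : ∀ p ∈ Q, ENNReal.ofReal (Real.sqrt (1 + swirl (V p.1) p.2 ^ 2)) ^ (5 / 2 * (4 / 3 : ℝ)) ≤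
      2 ^ (7 / 3 : ℝ) * (1 + ‖V p.1 p.2‖ₑ ^ (10 / 3 : ℝ)) := by
    intro p hp
    have hσ : |swirl (V p.1) p.2| ≤ ‖V p.1 p.2‖ := by
      refine (abs_swirl_le_cylRadius_mul_norm' p.2 (V p.1 p.2)).trans ?_
      have hρ : cylRadius p.2 ≤ 1 :=
        ((SereginSverak2009.cylRadius_le_norm' p.2).trans (mem_closedBall_zero_iff.1 hp.2)).trans hr₁
      calc cylRadius p.2 * ‖V p.1 p.2‖ ≤ 1 * ‖V p.1 p.2‖ := mul_le_mul_of_nonneg_right hρ (norm_nonneg _)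
        _ = ‖V p.1 p.2‖ := one_mul _
    have hu : Real.sqrt (1 + swirl (V p.1) p.2 ^ 2) ≤ 1 + ‖V p.1 p.2‖ := by
      rw [Real.sqrt_le_left (by positivity)]
      nlinarith [norm_nonneg (V p.1 p.2), sq_abs (swirl (V p.1) p.2), abs_nonneg (swirl (V p.1) p.2)]
    have hu' : ENNReal.ofReal (Real.sqrt (1 + swirl (V p.1) p.2 ^ 2)) ≤ 1 + ‖V p.1 p.2‖ₑ := by
      refine (ENNReal.ofReal_le_ofReal hu).trans (le_of_eq ?_)
      rw [ENNReal.ofReal_add zero_le_one (norm_nonneg _), ENNReal.ofReal_one, ofReal_norm]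
    calc ENNReal.ofReal (Real.sqrt (1 + swirl (V p.1) p.2 ^ 2)) ^ (5 / 2 * (4 / 3 : ℝ))
        ≤ (1 + ‖V p.1 p.2‖ₑ) ^ (5 / 2 * (4 / 3 : ℝ)) := ENNReal.rpow_le_rpow hu' (by norm_num)
      _ = (1 + ‖V p.1 p.2‖ₑ) ^ (10 / 3 : ℝ) := by norm_num
      _ ≤ 2 ^ ((10 / 3 : ℝ) - 1) * (1 ^ (10 / 3 : ℝ) + ‖V p.1 p.2‖ₑ ^ (10 / 3 : ℝ)) :=
          ENNReal.rpow_add_le_mul_rpow_add_rpow _ _ (by norm_num)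
      _ = 2 ^ (7 / 3 : ℝ) * (1 + ‖V p.1 p.2‖ₑ ^ (10 / 3 : ℝ)) := by rw [ENNReal.one_rpow]; norm_num
  calc (∫⁻ p in Q, ENNReal.ofReal (Real.sqrt (1 + swirl (V p.1) p.2 ^ 2)) ^ (5 / 2 * (4 / 3 : ℝ))
        ∂((volume : Measure ℝ).prod (volume : Measure (EuclideanSpace ℝ (Fin 3)))))
      ≤ ∫⁻ p in Q, 2 ^ (7 / 3 : ℝ) * (1 + ‖V p.1 p.2‖ₑ ^ (10 / 3 : ℝ))
          ∂((volume : Measure ℝ).prod (volume : Measure (EuclideanSpace ℝ (Fin 3)))) :=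
        setLIntegral_mono' hQm hpt
    _ = 2 ^ (7 / 3 : ℝ) * (((volume : Measure ℝ).prod (volume : Measure (EuclideanSpace ℝ (Fin 3)))) Q +
          ∫⁻ p in Q, ‖V p.1 p.2‖ₑ ^ (10 / 3 : ℝ) ∂((volume : Measure ℝ).prod (volume : Measure (EuclideanSpace ℝ (Fin 3))))) := by
        rw [lintegral_const_mul' _ _ (ENNReal.rpow_ne_top_of_nonneg (by norm_num) (by norm_num)),
          lintegral_add_left measurable_const, setLIntegral_const, one_mul]

end Literature.Analysis.FluidPDE.Seregin2020

end
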